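import Mathlib
import Summits.Langlands.Langlands.Theses.OdlyzkoWorldSplit

/-! # OdlyzkoWorldSplit — proof of the glue item of the split of `AutomorphyLifting` (= Lift_w, stmt-Langlands-24016) into
`IrreducibleLargePrimeLifting ∧ IrreducibleSmallPrimeLifting ∧ CyclotomicReducibleLifting` (lens-5-g8 node `ImageThresholdSplit`).
Pure logic: strong induction on the rank n (`Nat.strong_induction_on`; the induction hypothesis IS the inlined hypothesis «Lift_w at every rank m < n»
of each child, passed as `ih` without restating it) + trichotomy `ℓ < 2(n+1) ∨ 2(n+1) ≤ ℓ` (`Nat.lt_or_ge`) + excluded middle on the dial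
«ρ̄|Γ_{K(ζ_ℓ)} absolutely irreducible», written by `by_contra` so that the dial is NEVER restated (robust to the gate's rendering).  To land as
`Summits/Langlands/Langlands/Theorems/OdlyzkoWorldSplitAutomorphyLiftingOfImsplit.lean` once the edit has created the glue item
`OdlyzkoWorldSplit.AutomorphyLifting_of_imsplit : Prop := IrreducibleLargePrimeLifting → IrreducibleSmallPrimeLifting → CyclotomicReducibleLifting → AutomorphyLifting`. -/

set_option linter.dupNamespace false -- project-wide option; `Summit.Langlands.Langlands` is the mandated namespace

namespace Summit.Langlands.Langlands.Theorems

open Summit.Langlands.Langlands.Theses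

/-- A† → F† → R† → Lift_w. -/
theorem AutomorphyLifting_of_imsplit_proof : OdlyzkoWorldSplit.AutomorphyLifting_of_imsplit := by
  intro hA hF hR K hFK hNK n
  revert K
  induction n using Nat.strong_induction_on with
  | _ n ih =>
    intro K _ _ hcpt hn ℓ _ ι ρ
    by_contra hno
    refine hno (hR K n hcpt hn ih ℓ ι ρ fun hc => ?_)
    rcases Nat.lt_or_ge ℓ (2 * (n + 1)) with hlt | hge
    · exact hno (hF K n hcpt hn ih ℓ ι ρ hlt hc)
    · exact hno (hA K n hcpt hn ih ℓ ι ρ hge hc)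

end Summit.Langlands.Langlands.Theorems
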